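import Summits.QuantumFields.YangMills.Theorems.SwapVirialDeficitBlowUpGnomonicBFibreDefs
import Summits.QuantumFields.YangMills.Theorems.SwapVirialDeficitBlowUpGnomonicXPlaneRotation
import Summits.QuantumFields.YangMills.Theorems.SwapVirialDeficitBlowUpGnomonicTr001Flat
import Summits.QuantumFields.YangMills.Theorems.SwapVirialDeficitBlowUpPeriodicHub
import HarnessLib

/-!
# Route `SwapVirialDeficit` (YangMills): THE EUCLIDEAN FIBRE CHART OF SECTOR 001 — base `u = (t, y₀) ∈ ℝ²`, fibre `(δ, x₀, w∕√(1+y₀²) | y_⊥ | z | η_F) ∈ V_B`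
# (definitions + measure-theoretic API; cell ym-idea-1, LEAD g98 memo7 §D ∕ board 19:28Z, LEAD g99 order of work 21:25Z (c), letters of w3 g67 21:42Z; assembler fcl-p3 g48)

Sector 001 lives in the translated chart ✓`trGnoDeficit uJ z₁ (sectorChar z₁)` (g47 ✓`…TranslatedDefs`, ✓Defs §8–§9); after ✓`trGnoDeficit_eq_hubCot` its region
integrals are integrals on `ℝ × GnoCoord L` (hub letter `δ`, gnomonic coordinates `η`) against `μ_B = ((1+δ²)⁻¹)² dδ ⊗ ρ(η)dη`, exactly as for the B-tubes of sector 000.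
Its flat valley (✓`trGnoDeficit_001_flat_eq_zero`: `δ = 0`, `x = (0, t, −t y₀)`, `y = (y₀, 0, 0)`, `z = 0`, `η_F = 0`) is a GRAPH over the base `(t, y₀) ∈ ℝ²` whose
`x`-direction `(0, 1, −y₀)` turns with `y₀`.  THE 001 CHART straightens it with g47's skew rotation (✓`xSkewRot`, angle `−arctan y₀`) after putting the base into the
slots `(x₁, y₀)` by the coordinate swap `x₂ ↔ y₀` of w2 g59's B-chart ✓`gnoFibreBEquiv` (base slots `(x₁, x₂)`):
`gnoFibreTrEquiv := gnoFibreBEquiv ≫ (id × gnoSwapXY) ≫ (id × xSkewRot (−arctan ∘ y₀)) : (ℝ × ℝ) × V_B ≃ᵐ ℝ × GnoCoord L`,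
`((u₁,u₂), y) ↦ (δ = y_{t0}, x = rotX(−arctan u₂)(y_{t1}, u₁, y_{t2}), y-letter = (u₂, y_v), z = y_z, η_F = y_F)` — so the fibre letters are EXACTLY w3 g67's
(`δ`, `x₀`, `w∕√(1+y₀²)` with `w = x₁y₀ + x₂`, `y_⊥`, `z`, `η_F`) and the base point `u ↦ (0, ((0, u₁∕√(1+u₂²), −u₁u₂∕√(1+u₂²)), (u₂,0,0)), 0, 0)` is the flat valley
with `t = u₁∕√(1+u₂²)`, `y₀ = u₂`.  The fibre type is the SAME `V_B = GnoFibreB L` (`2α + 1` dimensions) as for (S-B), so w2's δ-in-fibre fibred Laplace lemma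
(✓`laplaceMethod_quantitative_fibred_chart_cubic_offBound_on` as instantiated in ✓`…BTubeFibred*`) applies with this chart in place of `gnoFibreBEquiv`.

* §1 `gnoSwapIdx`, `gnoSwapXYPair` (the slot swap `x₂ ↔ y₀` on `ℝ³ × ℝ³` as a coordinate permutation), `gnoSwapXY : GnoCoord L ≃ᵐ GnoCoord L`; pointwise formulas,
  ★ `volume_preserving_gnoSwapXY` (✓`volume_measurePreserving_piCongrLeft` ∕ `…sumPiEquivProdPi`), `gnoDensity_gnoSwapXY`;
* §2 `gnoFibreTrEquiv`, `gnoFibreTrEquiv_apply'`, `gnoFibreTrEquiv_fst`, ★★ `volume_preserving_gnoFibreTrEquiv`, ★ `volume_withDensity_eq_map_gnoFibreTrEquiv`;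
  §2b the linear part `gnoTrLin θ`, the fibre embedding `gnoFibreTrEmb u₂ : V_B →L ℝ × GnoCoord L` (a CLM — the chart is AFFINE along each fibre, as the Taylor jets want);
* §3 `gnoBaseTr u` (the base point), `gnoFibreTrEquiv_zero`, ★ `gnoFibreTrEquiv_apply` (`= gnoBaseTr u + gnoFibreTrEmb u.2 y`), `gnoFibreTrEquiv_apply_smul`,
  ★★ `trGnoDeficit_gnoBaseTr_eq_zero` (the base is the flat valley, every good sign pattern);
* §4 `bDensity_gnoFibreTrEquiv` (the density `((1+δ²)⁻¹)²ρ(η)` pulled back: an explicit product of one-letter weights — NOT `x₂ ↔ y₀`-symmetric, so it is recorded).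

HONEST LABEL: definitions and measure-theoretic API only (reviewed Defs file of the route's posited objects); the 001 fibred law (`stub_h001_good`), its floors (w3 g67),
(S-core-tip), (S-core-end), ⟨24197⟩ ∕ ⟨24194⟩ OPEN; item of record ⟨24085⟩ SubOctaveBounded aside ∕ untouched; the Yang–Mills mass gap is NOT proved; no summit is proved
by a line.  No instance, no notation, 0 `sorry`, standard axioms.  Seat ym-line-fcl-p3 g48 (cell ym-idea-1, free hands), `--supports stmt-QuantumFields-24197`.
References: [cite: Luscher1983, §2]; [cite: Breitung1994, §2.3 Definitions 4–5]; [folklore].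
-/

set_option autoImplicit false
set_option synthInstance.maxSize 1024

noncomputable section

open MeasureTheory Set
open scoped BigOperators ENNReal Quaternion

namespace Summit.QuantumFields.YangMills.Theorems.SwapVirialDeficit.BlowUpRing

open Summit.QuantumFields.YangMills.Theorems.FemtoTransferGap
open Summit.QuantumFields.YangMills.Theorems.SwapVirialDeficit.Gnomonic (normSq3 gnomonicWeight piWeight)
open Summit.QuantumFields.YangMills.Theorems.SwapVirialDeficit.SectorLaplace (z₁ uJ sectorChar)

variable {L : ℕ} [NeZero L]

/-! ## §1 The slot swap `x₂ ↔ y₀` -/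

/-- The coordinate permutation of `Fin 3 ⊕ Fin 3` exchanging the `x₂`-slot `inl 2` with the `y₀`-slot `inr 0`. [folklore] -/
def gnoSwapIdx : (Fin 3 ⊕ Fin 3) ≃ (Fin 3 ⊕ Fin 3) := Equiv.swap (Sum.inl 2) (Sum.inr 0)

/-- THE SLOT SWAP `x₂ ↔ y₀` ON `ℝ³ × ℝ³` as a measurable equivalence: `(x, y) ↦ ((x₀, x₁, y₀), (x₂, y₁, y₂))` (a coordinate permutation, read through
`ℝ³ × ℝ³ ≃ ℝ^{Fin 3 ⊕ Fin 3}`). [folklore] -/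
def gnoSwapXYPair : ((Fin 3 → ℝ) × (Fin 3 → ℝ)) ≃ᵐ ((Fin 3 → ℝ) × (Fin 3 → ℝ)) :=
  (((MeasurableEquiv.sumPiEquivProdPi fun _ : Fin 3 ⊕ Fin 3 => ℝ).symm.trans
      (MeasurableEquiv.piCongrLeft (fun _ : Fin 3 ⊕ Fin 3 => ℝ) gnoSwapIdx).symm).trans
    (MeasurableEquiv.sumPiEquivProdPi fun _ : Fin 3 ⊕ Fin 3 => ℝ))

omit [NeZero L] in
/-- The slot swap, pointwise. [folklore] -/
theorem gnoSwapXYPair_apply (x y : Fin 3 → ℝ) : gnoSwapXYPair (x, y) = ((![x 0, x 1, y 0] : Fin 3 → ℝ), (![x 2, y 1, y 2] : Fin 3 → ℝ)) := by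
  have key : ∀ i : Fin 3 ⊕ Fin 3, ((MeasurableEquiv.piCongrLeft (fun _ : Fin 3 ⊕ Fin 3 => ℝ) gnoSwapIdx).symm
      ((MeasurableEquiv.sumPiEquivProdPi fun _ : Fin 3 ⊕ Fin 3 => ℝ).symm (x, y))) i =
      ((MeasurableEquiv.sumPiEquivProdPi fun _ : Fin 3 ⊕ Fin 3 => ℝ).symm (x, y)) (gnoSwapIdx i) := fun i => rfl
  refine Prod.ext ?_ ?_
  · funext i
    show ((MeasurableEquiv.piCongrLeft (fun _ : Fin 3 ⊕ Fin 3 => ℝ) gnoSwapIdx).symm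
      ((MeasurableEquiv.sumPiEquivProdPi fun _ : Fin 3 ⊕ Fin 3 => ℝ).symm (x, y))) (Sum.inl i) = _
    rw [key]
    fin_cases i <;> rfl
  · funext i
    show ((MeasurableEquiv.piCongrLeft (fun _ : Fin 3 ⊕ Fin 3 => ℝ) gnoSwapIdx).symm
      ((MeasurableEquiv.sumPiEquivProdPi fun _ : Fin 3 ⊕ Fin 3 => ℝ).symm (x, y))) (Sum.inr i) = _
    rw [key]
    fin_cases i <;> rfl

omit [NeZero L] in
/-- The slot swap preserves Lebesgue measure on `ℝ³ × ℝ³`. [folklore] -/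
theorem volume_preserving_gnoSwapXYPair : MeasurePreserving gnoSwapXYPair volume volume :=
  (volume_measurePreserving_sumPiEquivProdPi fun _ : Fin 3 ⊕ Fin 3 => ℝ).comp
    ((((volume_measurePreserving_piCongrLeft (fun _ : Fin 3 ⊕ Fin 3 => ℝ) gnoSwapIdx).symm _).comp
      (volume_measurePreserving_sumPiEquivProdPi_symm fun _ : Fin 3 ⊕ Fin 3 => ℝ)))

/-- THE SLOT SWAP `x₂ ↔ y₀` OF THE GNOMONIC COORDINATES (`z` and the followers untouched). [folklore] -/
def gnoSwapXY : GnoCoord L ≃ᵐ GnoCoord L :=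
  MeasurableEquiv.prodCongr gnoSwapXYPair (MeasurableEquiv.refl ((Fin 3 → ℝ) × (Fol L → Fin 3 → ℝ)))

omit [NeZero L] in
/-- The slot swap of the gnomonic coordinates, pointwise. [folklore] -/
theorem gnoSwapXY_apply (η : GnoCoord L) :
    gnoSwapXY η = ((((![η.1.1 0, η.1.1 1, η.1.2 0] : Fin 3 → ℝ), (![η.1.1 2, η.1.2 1, η.1.2 2] : Fin 3 → ℝ)), η.2) : GnoCoord L) := by
  obtain ⟨⟨x, y⟩, r⟩ := η
  show (gnoSwapXYPair (x, y), r) = _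
  rw [gnoSwapXYPair_apply]

/-- ★ The slot swap preserves Lebesgue measure on `GnoCoord L`. [folklore] -/
theorem volume_preserving_gnoSwapXY : MeasurePreserving (gnoSwapXY (L := L)) volume volume :=
  volume_preserving_gnoSwapXYPair.prod (MeasurePreserving.id (volume : Measure ((Fin 3 → ℝ) × (Fol L → Fin 3 → ℝ))))

/-- The gnomonic density after the slot swap (NOT invariant: the one-letter weights of `x` and `y` see the exchanged slots). [folklore] -/
theorem gnoDensity_gnoSwapXY (η : GnoCoord L) :
    gnoDensity (gnoSwapXY η) =
      gnomonicWeight (![η.1.1 0, η.1.1 1, η.1.2 0] : Fin 3 → ℝ) * gnomonicWeight (![η.1.1 2, η.1.2 1, η.1.2 2] : Fin 3 → ℝ) *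
        gnomonicWeight η.2.1 * piWeight η.2.2 := by
  rw [gnoSwapXY_apply]; rfl

/-! ## §2 The 001 chart -/

/-- The angle function `y₀ ↦ −arctan y₀` is measurable. [folklore] -/
theorem measurable_negArctan : Measurable fun s : ℝ => -Real.arctan s := Real.continuous_arctan.measurable.neg

/-- ★ **THE 001 CHART** `(ℝ × ℝ) × V_B ≃ᵐ ℝ × GnoCoord L`: w2 g59's B-chart, then the slot swap `x₂ ↔ y₀`, then g47's skew rotation of the `x`-plane by `−arctan y₀`. [folklore] -/
def gnoFibreTrEquiv : ((ℝ × ℝ) × GnoFibreB L) ≃ᵐ ℝ × GnoCoord L :=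
  ((gnoFibreBEquiv (L := L)).trans (MeasurableEquiv.prodCongr (MeasurableEquiv.refl ℝ) (gnoSwapXY (L := L)))).trans
    (MeasurableEquiv.prodCongr (MeasurableEquiv.refl ℝ) (xSkewRotEquiv (L := L) (fun s => -Real.arctan s) measurable_negArctan))

/-- The 001 chart, pointwise: hub letter `δ = y_{t0}`, `x = rotX(−arctan u₂)(y_{t1}, u₁, y_{t2})`, `y = (u₂, y_{v0}, y_{v1})`, `z = y_z`, `η_F = y_F`. [folklore] -/
theorem gnoFibreTrEquiv_apply' (q : (ℝ × ℝ) × GnoFibreB L) :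
    gnoFibreTrEquiv q = (q.2 (Sum.inl (Sum.inl 0)),
      (((rotX (-Real.arctan q.1.2) (![q.2 (Sum.inl (Sum.inl 1)), q.1.1, q.2 (Sum.inl (Sum.inl 2))] : Fin 3 → ℝ),
          (![q.1.2, q.2 (Sum.inl (Sum.inr 0)), q.2 (Sum.inl (Sum.inr 1))] : Fin 3 → ℝ)),
        ((fun k => q.2 (Sum.inr (Sum.inl k))), (fun f k => q.2 (Sum.inr (Sum.inr (f, k)))))) : GnoCoord L)) := by
  have e1 : ∀ p : ℝ × GnoCoord L, (MeasurableEquiv.prodCongr (MeasurableEquiv.refl ℝ) (gnoSwapXY (L := L))) p = (p.1, gnoSwapXY p.2) := fun p => rfl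
  have e2 : ∀ p : ℝ × GnoCoord L, (MeasurableEquiv.prodCongr (MeasurableEquiv.refl ℝ) (xSkewRotEquiv (L := L) (fun s => -Real.arctan s) measurable_negArctan)) p =
      (p.1, xSkewRot (fun s => -Real.arctan s) p.2) := fun p => rfl
  unfold gnoFibreTrEquiv
  rw [MeasurableEquiv.coe_trans, MeasurableEquiv.coe_trans, Function.comp_apply, Function.comp_apply, e1, e2, gnoFibreBEquiv_apply', gnoSwapXY_apply,
    xSkewRot_apply]
  simp only [Matrix.cons_val_zero, Matrix.cons_val_one, Matrix.cons_val_two, Matrix.head_cons, Matrix.tail_cons]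

/-- The hub letter of the 001 chart is the fibre coordinate `t0`. [folklore] -/
theorem gnoFibreTrEquiv_fst (q : (ℝ × ℝ) × GnoFibreB L) : (gnoFibreTrEquiv q).1 = q.2 (Sum.inl (Sum.inl 0)) := by
  rw [gnoFibreTrEquiv_apply']

/-- ★★ **THE 001 CHART PRESERVES VOLUME**: `(gnoFibreTrEquiv)_*(vol_{ℝ×ℝ} ⊗ vol_{V_B}) = vol_{ℝ × GnoCoord L}`. [folklore] -/
theorem volume_preserving_gnoFibreTrEquiv : MeasurePreserving (gnoFibreTrEquiv (L := L)) volume volume := by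
  have h1 : MeasurePreserving (gnoFibreBEquiv (L := L)) volume volume := volume_preserving_gnoFibreBEquiv
  have h2 : MeasurePreserving (fun p : ℝ × GnoCoord L => (p.1, gnoSwapXY p.2)) (volume : Measure (ℝ × GnoCoord L)) (volume : Measure (ℝ × GnoCoord L)) :=
    (MeasurePreserving.id (volume : Measure ℝ)).prod volume_preserving_gnoSwapXY
  have h3 : MeasurePreserving (fun p : ℝ × GnoCoord L => (p.1, xSkewRot (fun s => -Real.arctan s) p.2)) (volume : Measure (ℝ × GnoCoord L))
      (volume : Measure (ℝ × GnoCoord L)) :=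
    (MeasurePreserving.id (volume : Measure ℝ)).prod (measurePreserving_xSkewRot (L := L) measurable_negArctan)
  have e : (gnoFibreTrEquiv (L := L) : (ℝ × ℝ) × GnoFibreB L → ℝ × GnoCoord L) =
      (fun p : ℝ × GnoCoord L => (p.1, xSkewRot (fun s => -Real.arctan s) p.2)) ∘ (fun p : ℝ × GnoCoord L => (p.1, gnoSwapXY p.2)) ∘ gnoFibreBEquiv := by
    funext q; rfl
  rw [e]
  exact h3.comp (h2.comp h1)

/-- ★ **THE GLOBAL 001 CHART IDENTITY** for a density `ρ` on `ℝ × GnoCoord L` (e.g. `ρ(δ,η) = ((1+δ²)⁻¹)²·gnoDensity η`):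
`vol·ρ = (gnoFibreTrEquiv)_*((vol_{ℝ×ℝ} ⊗ vol_{V_B})·(ρ ∘ gnoFibreTrEquiv))`. [folklore] -/
theorem volume_withDensity_eq_map_gnoFibreTrEquiv {ρ : ℝ × GnoCoord L → ℝ≥0∞} (hρ : Measurable ρ) :
    (volume : Measure (ℝ × GnoCoord L)).withDensity ρ =
      (((volume : Measure (ℝ × ℝ)).prod (volume : Measure (GnoFibreB L))).withDensity (ρ ∘ gnoFibreTrEquiv)).map (gnoFibreTrEquiv (L := L)) := by
  have hv : (volume : Measure (ℝ × GnoCoord L)) = ((volume : Measure (ℝ × ℝ)).prod (volume : Measure (GnoFibreB L))).map (gnoFibreTrEquiv (L := L)) :=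
    (volume_preserving_gnoFibreTrEquiv (L := L)).map_eq.symm
  rw [hv, Literature.Analysis.Asymptotics.withDensity_map_eq_map_withDensity_comp (gnoFibreTrEquiv (L := L)).measurable hρ]

/-! ## §2b The chart is affine along each fibre: `gnoFibreTrEquiv (u, y) = gnoBaseTr u + gnoFibreTrEmb u.2 y` -/

/-- The linear part of the 001 chart at base angle `θ`: `(δ, η) ↦ (δ, ((rotX θ (x₀, x₁, y₀), (x₂, y₁, y₂)), z, η_F))` (slot swap, then rotation of the
`x`-plane by the FIXED angle `θ`) as a linear map. [folklore] -/
def gnoTrLin (θ : ℝ) : (ℝ × GnoCoord L) →ₗ[ℝ] (ℝ × GnoCoord L) where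
  toFun p := (p.1, ((((rotX θ (![p.2.1.1 0, p.2.1.1 1, p.2.1.2 0] : Fin 3 → ℝ)), (![p.2.1.1 2, p.2.1.2 1, p.2.1.2 2] : Fin 3 → ℝ)), p.2.2) : GnoCoord L))
  map_add' p q := by
    refine Prod.ext rfl (Prod.ext (Prod.ext ?_ ?_) rfl)
    · funext k; fin_cases k <;> simp [rotX] <;> ring
    · funext k; fin_cases k <;> simp
  map_smul' c p := by
    refine Prod.ext rfl (Prod.ext (Prod.ext ?_ ?_) rfl)
    · funext k; fin_cases k <;> simp [rotX] <;> ring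
    · funext k; fin_cases k <;> simp

omit [NeZero L] in
/-- `gnoTrLin θ`, pointwise. [folklore] -/
theorem gnoTrLin_apply (θ : ℝ) (p : ℝ × GnoCoord L) :
    gnoTrLin θ p = (p.1, ((((rotX θ (![p.2.1.1 0, p.2.1.1 1, p.2.1.2 0] : Fin 3 → ℝ)), (![p.2.1.1 2, p.2.1.2 1, p.2.1.2 2] : Fin 3 → ℝ)), p.2.2) : GnoCoord L)) := rfl

/-- THE 001 FIBRE EMBEDDING over the base coordinate `y₀ = u₂`: `y ↦ (y_{t0}, ((rotX(−arctan u₂)(y_{t1}, 0, y_{t2}), (0, y_{v0}, y_{v1})), y_z, y_F))`, a continuous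
linear map `V_B →L ℝ × GnoCoord L` (w2's ✓`gnoFibreBEmb` followed by `gnoTrLin (−arctan u₂)`). [folklore] -/
def gnoFibreTrEmb (y₀ : ℝ) : GnoFibreB L →L[ℝ] ℝ × GnoCoord L :=
  (LinearMap.toContinuousLinearMap (gnoTrLin (L := L) (-Real.arctan y₀))).comp (gnoFibreBEmb (L := L))

/-- The 001 fibre embedding, pointwise. [folklore] -/
theorem gnoFibreTrEmb_apply (y₀ : ℝ) (y : GnoFibreB L) :
    gnoFibreTrEmb y₀ y = (y (Sum.inl (Sum.inl 0)),
      (((rotX (-Real.arctan y₀) (![y (Sum.inl (Sum.inl 1)), 0, y (Sum.inl (Sum.inl 2))] : Fin 3 → ℝ),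
          (![0, y (Sum.inl (Sum.inr 0)), y (Sum.inl (Sum.inr 1))] : Fin 3 → ℝ)),
        ((fun k => y (Sum.inr (Sum.inl k))), (fun f k => y (Sum.inr (Sum.inr (f, k)))))) : GnoCoord L)) := by
  show gnoTrLin (-Real.arctan y₀) (gnoFibreBEmb y) = _
  rw [gnoFibreBEmb_apply, gnoTrLin_apply]
  simp only [Matrix.cons_val_zero, Matrix.cons_val_one, Matrix.cons_val_two, Matrix.head_cons, Matrix.tail_cons]

omit [NeZero L] in
/-- `rotX θ` is additive in the vector (used to split base and fibre). [folklore] -/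
theorem rotX_add_vec (θ : ℝ) (a b : Fin 3 → ℝ) : rotX θ (a + b) = rotX θ a + rotX θ b := by
  funext k; fin_cases k <;> simp [rotX] <;> ring

omit [NeZero L] in
/-- `rotX θ (s • a) = s • rotX θ a`. [folklore] -/
theorem rotX_smul_vec (θ s : ℝ) (a : Fin 3 → ℝ) : rotX θ (s • a) = s • rotX θ a := by
  funext k; fin_cases k <;> simp [rotX] <;> ring

/-! ## §3 The base point is the flat valley of sector 001 -/

/-- THE 001 BASE POINT over `u = (u₁, u₂)`: hub letter `δ = 0`, `x = (0, u₁∕√(1+u₂²), −u₁u₂∕√(1+u₂²))`, `y = (u₂, 0, 0)`, `z = 0`, followers `0`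
(the flat valley of ✓`trGnoDeficit_001_flat_eq_zero` with `t = u₁∕√(1+u₂²)`, `y₀ = u₂`). [folklore] -/
def gnoBaseTr (u : ℝ × ℝ) : ℝ × GnoCoord L :=
  (0, ((((![0, u.1 / Real.sqrt (1 + u.2 ^ 2), -(u.1 / Real.sqrt (1 + u.2 ^ 2) * u.2)] : Fin 3 → ℝ), (![u.2, 0, 0] : Fin 3 → ℝ)),
    ((0 : Fin 3 → ℝ), (0 : Fol L → Fin 3 → ℝ))) : GnoCoord L))

/-- ★ The 001 chart at the zero fibre vector is the base point. [folklore] -/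
theorem gnoFibreTrEquiv_zero (u : ℝ × ℝ) : gnoFibreTrEquiv (u, (0 : GnoFibreB L)) = gnoBaseTr u := by
  rw [gnoFibreTrEquiv_apply', gnoBaseTr]
  have hc : Real.cos (-Real.arctan u.2) = 1 / Real.sqrt (1 + u.2 ^ 2) := by rw [Real.cos_neg, Real.cos_arctan]
  have hs : Real.sin (-Real.arctan u.2) = -(u.2 / Real.sqrt (1 + u.2 ^ 2)) := by rw [Real.sin_neg, Real.sin_arctan]
  refine Prod.ext (by simp) (Prod.ext (Prod.ext ?_ ?_) (Prod.ext ?_ ?_))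
  · funext k
    fin_cases k
    · simp [rotX]
    · simp [rotX, hc, hs]; ring
    · simp [rotX, hc, hs]; ring
  · funext k; fin_cases k <;> simp
  · funext k; simp
  · funext f k; simp

/-- ★ **THE 001 CHART IS AFFINE ALONG EACH FIBRE**: `gnoFibreTrEquiv (u, y) = gnoBaseTr u + gnoFibreTrEmb u.2 y`. [folklore] -/
theorem gnoFibreTrEquiv_apply (u : ℝ × ℝ) (y : GnoFibreB L) : gnoFibreTrEquiv (u, y) = gnoBaseTr u + gnoFibreTrEmb u.2 y := by
  rw [← gnoFibreTrEquiv_zero, gnoFibreTrEquiv_apply', gnoFibreTrEquiv_apply', gnoFibreTrEmb_apply]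
  have hx : (![y (Sum.inl (Sum.inl 1)), u.1, y (Sum.inl (Sum.inl 2))] : Fin 3 → ℝ) =
      (![(0 : GnoFibreB L) (Sum.inl (Sum.inl 1)), u.1, (0 : GnoFibreB L) (Sum.inl (Sum.inl 2))] : Fin 3 → ℝ) +
        (![y (Sum.inl (Sum.inl 1)), 0, y (Sum.inl (Sum.inl 2))] : Fin 3 → ℝ) := by
    funext k; fin_cases k <;> simp
  refine Prod.ext (by simp) (Prod.ext (Prod.ext ?_ ?_) (Prod.ext ?_ ?_))
  · show rotX (-Real.arctan u.2) _ = rotX (-Real.arctan u.2) _ + rotX (-Real.arctan u.2) _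
    rw [← rotX_add_vec, hx]
  · funext k; fin_cases k <;> simp
  · funext k; simp
  · funext f k; simp

/-- The 001 chart along a ray: `gnoFibreTrEquiv (u, s • y) = gnoBaseTr u + s • gnoFibreTrEmb u.2 y`. [folklore] -/
theorem gnoFibreTrEquiv_apply_smul (u : ℝ × ℝ) (s : ℝ) (y : GnoFibreB L) : gnoFibreTrEquiv (u, s • y) = gnoBaseTr u + s • gnoFibreTrEmb u.2 y := by
  rw [gnoFibreTrEquiv_apply, map_smul]

/-- ★★ **THE 001 BASE IS FLAT**: for sign patterns with the slaving letter and all followers on `+`, the translated deficit vanishes at every base point,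
`trGnoDeficit uJ z₁ (sectorChar z₁) (hubAt (gnoBaseTr u).1 1) ε (gnoBaseTr u).2 = 0` (✓`trGnoDeficit_001_flat_eq_zero` at the end hub `hubAt 0 1 = i`). [cite: tHooft1979] -/
theorem trGnoDeficit_gnoBaseTr_eq_zero (ε : GnoSign L) (hz : ε.2.1 = true) (hF : ε.2.2 = fun _ => true) (u : ℝ × ℝ) :
    trGnoDeficit uJ z₁ (sectorChar z₁) (hubAt (gnoBaseTr (L := L) u).1 1) ε (gnoBaseTr (L := L) u).2 = 0 := by
  have h1 : (gnoBaseTr (L := L) u).1 = 0 := rfl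
  rw [h1]
  have hne : hubAt 0 1 ≠ 0 := fun h => by
    have h1 : (hubAt 0 1).imI = (0 : ℍ).imI := by rw [h]
    simp [hubAt] at h1
  have hre : (hubAt 0 1).re = 0 := by simp [hubAt]
  exact trGnoDeficit_001_flat_eq_zero hne hre ε hz hF (u.1 / Real.sqrt (1 + u.2 ^ 2)) u.2

/-! ## §4 The density pulled back -/

/-- The density `((1+δ²)⁻¹)²·ρ(η)` of `μ_B` in the 001 chart: `δ = y_{t0}`, and `ρ` is the product of the one-letter weights of `x′ = (y_{t1}, u₁, y_{t2})`
(the skew rotation does not change `|x|²`), `y′ = (u₂, y_{v0}, y_{v1})`, `z`, `η_F`. [folklore] -/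
theorem bDensity_gnoFibreTrEquiv (u : ℝ × ℝ) (y : GnoFibreB L) :
    ((1 + (gnoFibreTrEquiv (u, y)).1 ^ 2)⁻¹) ^ 2 * gnoDensity (gnoFibreTrEquiv (u, y)).2 =
      ((1 + y (Sum.inl (Sum.inl 0)) ^ 2)⁻¹) ^ 2 *
        (gnomonicWeight (![y (Sum.inl (Sum.inl 1)), u.1, y (Sum.inl (Sum.inl 2))] : Fin 3 → ℝ) *
          gnomonicWeight (![u.2, y (Sum.inl (Sum.inr 0)), y (Sum.inl (Sum.inr 1))] : Fin 3 → ℝ) *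
          gnomonicWeight (fun k => y (Sum.inr (Sum.inl k))) * piWeight (fun f k => y (Sum.inr (Sum.inr (f, k))))) := by
  rw [gnoFibreTrEquiv_apply']
  simp only [gnoDensity, gnomonicWeight_rotX]

end Summit.QuantumFields.YangMills.Theorems.SwapVirialDeficit.BlowUpRing

end
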